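import Literature.Probability.Percolation.DualContours
import Literature.Probability.Percolation.PlanarDuality
import HarnessLib

/-!
# Transplant sharpness VI — mesh-`M` coarse-graining of bond configurations on `ℤ²`: walls and the coarse configuration

builds on p205010 (kernel theorem, internal audit signed; external expert review pending).
Status sentence (coordinator 2026-08-20T04:30Z): "θ(p_c) = 0 on ℤ^d, all d ≥ 2 — kernel-verified (Lean 4/Mathlib,
standard axioms); internal adversarial audit SIGNED 2026-08-20 04:29Z; external expert review pending."

Lane `prim-bschramm`, seat p5 (sharpness); memo `run/shared/lean/prim/bschramm/prim-bschramm-p5-g19/GRIDWEDGE-PROOF.md`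
§4.2 and §7 (M1).  Part of module (M1) of the kernel route for the hard half of P5-SHARPNESS row 83 (the gridded
log-wedge `ℤ²[W ∪ L_M]` has the wedge's critical point).  Everything here is deterministic planar bookkeeping for the
square lattice and PROVED.

* `mem_dualConfig_step_iff` — a dual step of `ℤ²` is open in `dualConfig ω` iff the primal edge it crosses is not in
  `ω` (the tree's `dualEdge`/`crossedEdge` conventions: dual vertex `a` = plaquette with lower-left corner `a`);
* `wallEdge M x j t`, `coarseConfig M ω` — the junction lattice of mesh `M` rescaled to `ℤ²`: the coarse edge
  `{x, x + e_j}` stands for the WALL of `M` collinear lattice edges from `M x` to `M x + M e_j`, and it is OPEN in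
  `coarseConfig M ω` iff all `M` wall edges are open in `ω` (the wall is "non-passable");
* `coarse_dual_step_iff` — the coarse dual step from cell `c` in direction `dir` is open in
  `dualConfig (coarseConfig M ω)` iff some edge of the crossed wall is not in `ω` (the wall is "passable");
* `wallEdge_right_eq`, `wallEdge_up_eq` — the walls between a cell and its right / upper neighbour in coordinates.

Companions: `SharpnessGridCells.lean` (cells, plaquettes, relative coordinates) and `SharpnessGridPassage.lean` (the
realisation of passable walls between clear cells by blocked dual paths).  This is the device by which rectangle-crossing
duality (`lrCrossing_xor_dualTBCrossing_holds`) and Peierls counting, applied to the ELEMENT `coarseConfig M ω`, produce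
blocked dual circuits for the gridded wedge (GRIDWEDGE-PROOF §4.2–4.3).

References: G. Grimmett, *Percolation*, 2nd ed. (1999), §1.4 pp. 16–17 (dual lattice), §11.2 (planar duality);
H. Kesten, *Percolation Theory for Mathematicians* (1982), §2.2 (block lattices are folklore).
-/

namespace Summit.CriticalPhenomena.PercolationContinuityZ3.Theorems.TransplantSharpness

open Literature.Probability.Percolation Literature.Probability.LatticeModels
open Literature.Probability.Percolation.Contour (dualEdge_crossedEdge stepVec_ne_zero)

/-! ## Dual steps of `ℤ²`: open in `dualConfig ω` iff the crossed edge is not in `ω` -/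

/-- A dual step is a lattice edge (dual vertices are indexed by `Site 2`). [folklore] -/
theorem step_mem_edgeSet (a : Site 2) (dir : Fin 2 × Bool) :
    s(a, a + stepVec dir) ∈ (zdGraph 2).edgeSet := by
  rw [SimpleGraph.mem_edgeSet, zdGraph_adj_iff_stepVec]
  exact ⟨dir, rfl⟩

/-- `a ≠ a + stepVec dir`. [folklore] -/
theorem ne_add_stepVec (a : Site 2) (dir : Fin 2 × Bool) : a ≠ a + stepVec dir := by
  intro h
  have := stepVec_ne_zero dir
  exact this (by simpa using h.symm)

/-- **A dual step is open in `dualConfig ω` iff the primal edge it crosses is not in `ω`** (for `ω ⊆ E(ℤ²)`;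
Grimmett 1999 §11.2 "open dual edges cross closed primal edges", with the tree's `dualEdge_crossedEdge` and the
injectivity `dualEdge_injOn_holds`). [folklore] -/
theorem mem_dualConfig_step_iff {ω : BondConfig (Site 2)} (hω : ω ⊆ (zdGraph 2).edgeSet) (a : Site 2)
    (dir : Fin 2 × Bool) : s(a, a + stepVec dir) ∈ dualConfig ω ↔ crossedEdge a dir ∉ ω := by
  rw [mem_dualConfig_iff]
  constructor
  · rintro ⟨-, h⟩ hmem
    exact h _ hmem (dualEdge_crossedEdge a dir)
  · intro h
    refine ⟨step_mem_edgeSet a dir, fun e' he' heq => h ?_⟩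
    have hinj := dualEdge_injOn_holds (hω he') (crossedEdge_mem_edgeSet a dir)
      (heq.trans (dualEdge_crossedEdge a dir).symm)
    rwa [← hinj]

/-- The dual step as an adjacency of the open dual graph. [folklore] -/
theorem openGraph_dualConfig_adj_iff {ω : BondConfig (Site 2)} (hω : ω ⊆ (zdGraph 2).edgeSet) (a : Site 2)
    (dir : Fin 2 × Bool) : (openGraph (dualConfig ω)).Adj a (a + stepVec dir) ↔ crossedEdge a dir ∉ ω := by
  rw [openGraph_adj, mem_dualConfig_step_iff hω]
  exact ⟨fun h => h.1, fun h => ⟨h, ne_add_stepVec a dir⟩⟩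

/-! ## Walls and the coarse configuration -/

/-- The `t`-th lattice edge of the WALL represented by the coarse edge `{x, x + e_j}`: the edge from
`M x + t e_j` to `M x + (t+1) e_j`. House notation, GRIDWEDGE-PROOF §4.2. -/
def wallEdge (M : ℕ) (x : Site 2) (j : Fin 2) (t : ℕ) : Sym2 (Site 2) :=
  s((M : ℤ) • x + Pi.single j (t : ℤ), (M : ℤ) • x + Pi.single j ((t : ℤ) + 1))

/-- Wall edges are lattice edges. [folklore] -/
theorem wallEdge_mem_edgeSet (M : ℕ) (x : Site 2) (j : Fin 2) (t : ℕ) :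
    wallEdge M x j t ∈ (zdGraph 2).edgeSet := by
  rw [wallEdge, SimpleGraph.mem_edgeSet, zdGraph_adj_iff]
  refine ⟨j, Or.inl ?_⟩
  rw [add_assoc, ← Pi.single_add]

/-- The COARSE CONFIGURATION of mesh `M`: the coarse edge `{x, x + e_j}` of `ℤ²` is open iff every one of the `M`
edges of its wall is open in `ω` (the wall is non-passable). House notation, GRIDWEDGE-PROOF §4.2/§7 (M1). -/
def coarseConfig (M : ℕ) (ω : BondConfig (Site 2)) : BondConfig (Site 2) :=
  {e | ∃ (x : Site 2) (j : Fin 2), e = s(x, x + Pi.single j 1) ∧ ∀ t : ℕ, t < M → wallEdge M x j t ∈ ω}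

/-- The coarse configuration lives on lattice edges. [folklore] -/
theorem coarseConfig_subset_edgeSet (M : ℕ) (ω : BondConfig (Site 2)) :
    coarseConfig M ω ⊆ (zdGraph 2).edgeSet := by
  rintro e ⟨x, j, rfl, -⟩
  rw [SimpleGraph.mem_edgeSet, zdGraph_adj_iff]
  exact ⟨j, Or.inl rfl⟩

/-- The coarse configuration is monotone in `ω`. [folklore] -/
theorem coarseConfig_mono (M : ℕ) : Monotone (coarseConfig M) := by
  rintro ω ω' h e ⟨x, j, rfl, hw⟩
  exact ⟨x, j, rfl, fun t ht => h (hw t ht)⟩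

/-- Unit-step edges determine their lower endpoint and direction: `{x, x + e_j} = {y, y + e_k}` forces `x = y` and
`j = k`. [folklore] -/
theorem eq_of_unitEdge_eq {x y : Site 2} {j k : Fin 2}
    (h : s(x, x + Pi.single j (1 : ℤ)) = s(y, y + Pi.single k (1 : ℤ))) : x = y ∧ j = k := by
  rw [Sym2.eq_iff] at h
  rcases h with ⟨h1, h2⟩ | ⟨h1, h2⟩
  · subst h1
    have h3 : (Pi.single j (1 : ℤ) : Site 2) = Pi.single k 1 := add_left_cancel h2
    refine ⟨rfl, ?_⟩
    by_contra hjk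
    have := congr_fun h3 j
    simp [Pi.single_eq_of_ne hjk] at this
  · exfalso
    have h3 : y + (Pi.single k (1 : ℤ) + Pi.single j 1) = y + 0 := by rw [← add_assoc, ← h1, h2, add_zero]
    have h4 := congr_fun (add_left_cancel h3) k
    rcases eq_or_ne j k with rfl | hjk
    · simp at h4
    · simp [Pi.single_eq_of_ne hjk.symm] at h4

/-- Membership of a unit-step edge in the coarse configuration. [folklore] -/
theorem unitEdge_mem_coarseConfig_iff {M : ℕ} {ω : BondConfig (Site 2)} {x : Site 2} {j : Fin 2} :
    s(x, x + Pi.single j (1 : ℤ)) ∈ coarseConfig M ω ↔ ∀ t : ℕ, t < M → wallEdge M x j t ∈ ω := by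
  constructor
  · rintro ⟨y, k, heq, hw⟩
    obtain ⟨rfl, rfl⟩ := eq_of_unitEdge_eq heq
    exact hw
  · intro h
    exact ⟨x, j, rfl, h⟩

/-- The lower endpoint of the coarse edge crossed by the dual step from cell `c` in direction `dir`
(`crossedEdge c dir = {wallBase c dir, wallBase c dir + e_{dir.1.rev}}`). [folklore] -/
def wallBase (c : Site 2) (dir : Fin 2 × Bool) : Site 2 :=
  if dir.2 then c + Pi.single dir.1 1 else c

/-- `crossedEdge` in terms of `wallBase`. [folklore] -/
theorem crossedEdge_eq_wallBase (c : Site 2) (dir : Fin 2 × Bool) :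
    crossedEdge c dir = s(wallBase c dir, wallBase c dir + Pi.single dir.1.rev 1) := by
  simp only [crossedEdge, wallBase]

/-- **Coarse dual steps**: the dual step from cell `c` in direction `dir` is open in `dualConfig (coarseConfig M ω)`
iff the crossed wall is PASSABLE, i.e. some one of its `M` edges is not in `ω`. [folklore] -/
theorem coarse_dual_step_iff (M : ℕ) (ω : BondConfig (Site 2)) (c : Site 2) (dir : Fin 2 × Bool) :
    s(c, c + stepVec dir) ∈ dualConfig (coarseConfig M ω) ↔
      ∃ t : ℕ, t < M ∧ wallEdge M (wallBase c dir) dir.1.rev t ∉ ω := by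
  rw [mem_dualConfig_step_iff (coarseConfig_subset_edgeSet M ω), crossedEdge_eq_wallBase,
    unitEdge_mem_coarseConfig_iff]
  simp only [not_forall, exists_prop]


/-! ## The two walls of a cell towards its right and upper neighbours, in coordinates -/

/-- The wall between `c` and `c + e₀`, edge `t`, in coordinates relative to `c`. [folklore] -/
theorem wallEdge_right_eq (M : ℕ) (c : Site 2) (t : ℕ) :
    wallEdge M (c + Pi.single 0 1) 1 t = s((M : ℤ) • c + ![(M : ℤ), t], (M : ℤ) • c + ![(M : ℤ), t + 1]) := by
  unfold wallEdge
  congr 1 <;> (ext k; fin_cases k <;> simp)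

/-- The wall between `c` and `c + e₁`, edge `t`, in coordinates relative to `c`. [folklore] -/
theorem wallEdge_up_eq (M : ℕ) (c : Site 2) (t : ℕ) :
    wallEdge M (c + Pi.single 1 1) 0 t = s((M : ℤ) • c + ![(t : ℤ), M], (M : ℤ) • c + ![(t : ℤ) + 1, M]) := by
  unfold wallEdge
  congr 1 <;> (ext k; fin_cases k <;> simp)


end Summit.CriticalPhenomena.PercolationContinuityZ3.Theorems.TransplantSharpness
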